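import Summits.PneNP.PneNP.Theorems.OneSliceConstantBandTransferStepAux
import Literature.Computability.Complexity.RossmanMonotoneCliqueGraphs
import Literature.Computability.Complexity.CliqueThresholdBounds
import Summits.PneNP.PneNP.Theorems.OneSliceConstantBandNearCliqueContiguityPairs

/-!
# Near-clique contiguity on a critical slice (S2 of the line `flat-prior-relative-minterms`), part 3: second moment

The inner pair sum at a fixed `(A,e)` (diagonal + far + near pairs) and the second-moment bound at explicit
largeness hypotheses:
`#slice_m·Σ_y X(y)² ≤ (1/(E-term) + [N]_K/[N-K]_K-ratio + near-pair sum)·(Σ_y X(y))²`. [folklore]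
-/

noncomputable section
namespace Summit.PneNP.PneNP.Cruxes.ConstantBand.FlatPriorRelativeMinterms

set_option linter.dupNamespace false

open Literature.Computability.Complexity Filter Classical
open Finset hiding slice
open Summit.PneNP.PneNP.Theorems.ConstantBand.Negative

section Moment

set_option quotPrecheck false

variable {n : ℕ}

/-- The `k`-subsets of the vertex set. -/
local notation "𝒜⟦" n ", " k "⟧" => powersetCard k (univ : Finset (Fin n))

/-- The admissible pairs `(A, e)`: a `k`-set `A` and an edge `e` of `K_A`. -/
local notation "𝒫⟦" n ", " k "⟧" =>
  Finset.filter (fun ae : Finset (Fin n) × Edge n => ae.2 ∈ edgesIn ae.1)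
    ((powersetCard k (univ : Finset (Fin n))) ×ˢ (univ : Finset (Edge n)))

/-- The pattern of `(A, e)` in `y`: `K_A − e ⊆ on(y)` and `e ∉ on(y)`. -/
local notation "Pat⟦" A ", " e ", " y "⟧" =>
  ((∀ e' ∈ edgesIn A, e' ≠ e → y e' = true) ∧ y e = false)

/-- The near-clique count `X(y) = #{(A,e) : K_A − e ⊆ on(y), e ∉ on(y)}`. -/
local notation "Xc⟦" n ", " k ", " y "⟧" =>
  Finset.card (Finset.filter (fun ae : Finset (Fin n) × Edge n => Pat⟦ae.1, ae.2, y⟧) 𝒫⟦n, k⟧)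

/-- **The inner pair sum at a fixed `(A,e)`**: diagonal `+` far pairs `+` near pairs,
`Σ_{(B,e')} #{y : both} ≤ #{y : pattern(A,e)} + C(n,k)·K·C(N-2K, m-2K+2)
  + K·#slice_m·Σ_{a=2}^{k-1} C(k,a)·C(n-k,k-a)·p^{2K-C(a,2)-2}`. [folklore] -/
theorem ncc_inner_le {k m : ℕ} {A : Finset (Fin n)} {e : Edge n} (hA : A ∈ 𝒜⟦n, k⟧)
    (he : e ∈ edgesIn A) {p : ℝ} (hp0 : 0 ≤ p) (hp1 : p ≤ 1) (hmN : m ≤ n.choose 2)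
    (hN : 0 < n.choose 2) (hmp : (m : ℝ) ≤ p * n.choose 2) :
    (∑ be ∈ 𝒫⟦n, k⟧, (#((slice n m).filter fun y => Pat⟦A, e, y⟧ ∧ Pat⟦be.1, be.2, y⟧) : ℝ)) ≤
      #((slice n m).filter fun y => Pat⟦A, e, y⟧) +
        (n.choose k : ℝ) * k.choose 2 * (n.choose 2 - 2 * k.choose 2).choose (m - (2 * k.choose 2 - 2)) +
        (k.choose 2 : ℝ) * #(slice n m) *
          ∑ a ∈ Ico 2 k, (k.choose a : ℝ) * (n - k).choose (k - a) * p ^ (2 * k.choose 2 - a.choose 2 - 2) := by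
  set cnt : Finset (Fin n) → Edge n → ℝ := fun B e' =>
    (#((slice n m).filter fun y => Pat⟦A, e, y⟧ ∧ Pat⟦B, e', y⟧) : ℝ) with hcnt
  set P₂ : ℕ := (n.choose 2 - 2 * k.choose 2).choose (m - (2 * k.choose 2 - 2)) with hP₂
  have hK : ∀ B ∈ 𝒜⟦n, k⟧, #(edgesIn B) = k.choose 2 := fun B hB => ncc_card_edgesIn_of_mem hB
  have hstep : (∑ be ∈ 𝒫⟦n, k⟧, (#((slice n m).filter fun y => Pat⟦A, e, y⟧ ∧ Pat⟦be.1, be.2, y⟧) : ℝ))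
      = ∑ B ∈ 𝒜⟦n, k⟧, ∑ e' ∈ edgesIn B, cnt B e' := ncc_sum_pairs k (fun be => cnt be.1 be.2)
  rw [hstep, ← add_sum_erase _ _ hA]
  -- the diagonal block `B = A`
  have hdiag : ∑ e' ∈ edgesIn A, cnt A e' = #((slice n m).filter fun y => Pat⟦A, e, y⟧) := by
    rw [← add_sum_erase _ _ he]
    have h0 : ∑ e' ∈ (edgesIn A).erase e, cnt A e' = 0 := by
      refine sum_eq_zero fun e' he' => ?_
      simp only [hcnt]
      rw [ncc_pat_pat_same (mem_erase.1 he').2 (mem_erase.1 he').1, card_empty, Nat.cast_zero]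
    rw [h0, add_zero]
    simp only [hcnt, and_self]
  -- far pairs
  have hfar : ∑ B ∈ ((𝒜⟦n, k⟧).erase A).filter (fun B => #(A ∩ B) ≤ 1), ∑ e' ∈ edgesIn B, cnt B e' ≤
      (n.choose k : ℝ) * k.choose 2 * P₂ := by
    calc ∑ B ∈ ((𝒜⟦n, k⟧).erase A).filter (fun B => #(A ∩ B) ≤ 1), ∑ e' ∈ edgesIn B, cnt B e'
        ≤ ∑ B ∈ ((𝒜⟦n, k⟧).erase A).filter (fun B => #(A ∩ B) ≤ 1), (k.choose 2 : ℝ) * P₂ := by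
          refine sum_le_sum fun B hB => ?_
          obtain ⟨hB1, hB2⟩ := mem_filter.1 hB
          have hB𝒜 := (mem_erase.1 hB1).2
          calc ∑ e' ∈ edgesIn B, cnt B e' ≤ ∑ _e' ∈ edgesIn B, (P₂ : ℝ) :=
                sum_le_sum fun e' he' => by
                  simp only [hcnt]
                  exact_mod_cast ncc_card_pat_pat_far hA hB𝒜 he he' hB2
            _ = _ := by rw [sum_const, nsmul_eq_mul, hK B hB𝒜]
      _ = #(((𝒜⟦n, k⟧).erase A).filter (fun B => #(A ∩ B) ≤ 1)) * ((k.choose 2 : ℝ) * P₂) := by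
          rw [sum_const, nsmul_eq_mul]
      _ ≤ (n.choose k : ℝ) * ((k.choose 2 : ℝ) * P₂) := by
          gcongr
          have : #(((𝒜⟦n, k⟧).erase A).filter (fun B => #(A ∩ B) ≤ 1)) ≤ n.choose k := by
            refine (card_le_card ((filter_subset _ _).trans (erase_subset _ _))).trans ?_
            rw [card_powersetCard, card_univ, Fintype.card_fin]
          exact_mod_cast this
      _ = _ := by ring
  -- near pairs
  have hnear : ∑ B ∈ ((𝒜⟦n, k⟧).erase A).filter (fun B => ¬ #(A ∩ B) ≤ 1), ∑ e' ∈ edgesIn B, cnt B e' ≤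
      (k.choose 2 : ℝ) * #(slice n m) *
        ∑ a ∈ Ico 2 k, (k.choose a : ℝ) * (n - k).choose (k - a) * p ^ (2 * k.choose 2 - a.choose 2 - 2) := by
    have hmaps : ∀ B ∈ ((𝒜⟦n, k⟧).erase A).filter (fun B => ¬ #(A ∩ B) ≤ 1), #(A ∩ B) ∈ Ico 2 k := by
      intro B hB
      obtain ⟨hB1, hB2⟩ := mem_filter.1 hB
      obtain ⟨hne, hB𝒜⟩ := mem_erase.1 hB1
      rw [mem_Ico]
      exact ⟨by omega, ncc_card_inter_lt hA hB𝒜 hne⟩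
    calc ∑ B ∈ ((𝒜⟦n, k⟧).erase A).filter (fun B => ¬ #(A ∩ B) ≤ 1), ∑ e' ∈ edgesIn B, cnt B e'
        ≤ ∑ B ∈ ((𝒜⟦n, k⟧).erase A).filter (fun B => ¬ #(A ∩ B) ≤ 1),
            (k.choose 2 : ℝ) * #(slice n m) * p ^ (2 * k.choose 2 - (#(A ∩ B)).choose 2 - 2) := by
          refine sum_le_sum fun B hB => ?_
          obtain ⟨hB1, -⟩ := mem_filter.1 hB
          have hB𝒜 := (mem_erase.1 hB1).2
          calc ∑ e' ∈ edgesIn B, cnt B e'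
              ≤ ∑ _e' ∈ edgesIn B, p ^ (2 * k.choose 2 - (#(A ∩ B)).choose 2 - 2) * #(slice n m) :=
                sum_le_sum fun e' _ => ncc_card_pat_pat_near e e' hA hB𝒜 hp0 hp1 hmN hN hmp
            _ = _ := by rw [sum_const, nsmul_eq_mul, hK B hB𝒜]; ring
      _ = (k.choose 2 : ℝ) * #(slice n m) * ∑ B ∈ ((𝒜⟦n, k⟧).erase A).filter (fun B => ¬ #(A ∩ B) ≤ 1),
            p ^ (2 * k.choose 2 - (#(A ∩ B)).choose 2 - 2) := by rw [mul_sum]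
      _ ≤ _ := by
          gcongr
          rw [← sum_fiberwise_of_maps_to hmaps]
          refine sum_le_sum fun a _ => ?_
          calc ∑ B ∈ (((𝒜⟦n, k⟧).erase A).filter (fun B => ¬ #(A ∩ B) ≤ 1)).filter (fun B => #(A ∩ B) = a),
                p ^ (2 * k.choose 2 - (#(A ∩ B)).choose 2 - 2)
              = ∑ B ∈ (((𝒜⟦n, k⟧).erase A).filter (fun B => ¬ #(A ∩ B) ≤ 1)).filter (fun B => #(A ∩ B) = a),
                p ^ (2 * k.choose 2 - a.choose 2 - 2) :=
                sum_congr rfl fun B hB => by rw [(mem_filter.1 hB).2]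
            _ = #((((𝒜⟦n, k⟧).erase A).filter (fun B => ¬ #(A ∩ B) ≤ 1)).filter (fun B => #(A ∩ B) = a)) *
                p ^ (2 * k.choose 2 - a.choose 2 - 2) := by rw [sum_const, nsmul_eq_mul]
            _ ≤ ((k.choose a * (n - k).choose (k - a) : ℕ) : ℝ) * p ^ (2 * k.choose 2 - a.choose 2 - 2) := by
                gcongr
                refine le_trans (card_le_card fun B hB => ?_) (ncc_card_fibre hA a)
                rw [mem_filter] at hB ⊢
                exact ⟨(mem_erase.1 (mem_filter.1 hB.1).1).2, hB.2⟩
            _ = _ := by push_cast; ring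
  rw [← sum_filter_add_sum_filter_not ((𝒜⟦n, k⟧).erase A) (fun B => #(A ∩ B) ≤ 1), hdiag]
  linarith [hfar, hnear]


/-- **Second-moment bound at explicit largeness hypotheses.** For `k ≥ 3`, `k ≤ n`, `2m ≤ N`, `2K ≤ m`
and densities `0 < ℓ`, `ℓ·N + K ≤ m + 2`, `m ≤ p·N`, `p ≤ 1` (`N = C(n,2)`, `K = C(k,2)`):
`#slice_m · Σ_y X(y)² ≤ (2/(C(n,k)·K·ℓ^{K-1}) + (N/(N+1-2K))^K
  + 4·Σ_{a=2}^{k-1} C(k,a)·C(n-k,k-a)·p^{2K-C(a,2)-2}/(C(n,k)·ℓ^{2K-2})) · (Σ_y X(y))²`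
(diagonal `1/E X`, far pairs `[N]_K/[N-K]_K`, near pairs). [folklore] -/
theorem ncc_moment_bound {k m : ℕ} (hk : 3 ≤ k) (hkn : k ≤ n) (h2m : 2 * m ≤ n.choose 2)
    (hKm : 2 * k.choose 2 ≤ m) {ℓ p : ℝ} (hℓ : 0 < ℓ) (hℓm : ℓ * n.choose 2 + k.choose 2 ≤ m + 2)
    (hmp : (m : ℝ) ≤ p * n.choose 2) (hp1 : p ≤ 1) :
    (#(slice n m) : ℝ) * ∑ y ∈ slice n m, (Xc⟦n, k, y⟧ : ℝ) ^ 2 ≤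
      (2 / ((n.choose k : ℝ) * k.choose 2 * ℓ ^ (k.choose 2 - 1)) +
        ((n.choose 2 : ℝ) / (n.choose 2 + 1 - 2 * k.choose 2)) ^ k.choose 2 +
        4 * (∑ a ∈ Ico 2 k, (k.choose a : ℝ) * (n - k).choose (k - a) *
            p ^ (2 * k.choose 2 - a.choose 2 - 2)) / ((n.choose k : ℝ) * ℓ ^ (2 * k.choose 2 - 2))) *
      (∑ y ∈ slice n m, (Xc⟦n, k, y⟧ : ℝ)) ^ 2 := by
  set N := n.choose 2 with hNq
  set K := k.choose 2 with hKq
  set C := n.choose k with hCq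
  set P₁ : ℕ := (N - K).choose (m - (K - 1)) with hP₁
  set P₂ : ℕ := (N - 2 * K).choose (m - (2 * K - 2)) with hP₂
  set Sa : ℝ := ∑ a ∈ Ico 2 k, (k.choose a : ℝ) * (n - k).choose (k - a) *
    p ^ (2 * K - a.choose 2 - 2) with hSa
  have hK3 : 3 ≤ K := by
    rw [hKq]
    exact (Nat.choose_le_choose 2 hk : Nat.choose 3 2 ≤ k.choose 2)
  have hC : 0 < C := Nat.choose_pos hkn
  have hmN : m ≤ N := by omega
  have hN : 0 < N := by omega
  have hM : #(slice n m) = N.choose m := ts_card_slice n m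
  have hCR : (0 : ℝ) < C := by exact_mod_cast hC
  have hKR : (0 : ℝ) < K := by exact_mod_cast (show 0 < K by omega)
  have hp0 : 0 ≤ p := by
    have h1 : (0 : ℝ) < m := by exact_mod_cast (show 0 < m by omega)
    have h2 : (0 : ℝ) < N := by exact_mod_cast hN
    nlinarith
  have hSa0 : 0 ≤ Sa := sum_nonneg fun a _ => by positivity
  -- first moment
  have hTot : (∑ y ∈ slice n m, (Xc⟦n, k, y⟧ : ℝ)) = (C : ℝ) * K * P₁ := by
    have h := ncc_sum_X (n := n) (k := k) (m := m) (by omega)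
    exact_mod_cast h
  -- second moment, bounded pairwise
  have hsq : (∑ y ∈ slice n m, (Xc⟦n, k, y⟧ : ℝ) ^ 2) ≤
      (C : ℝ) * K * P₁ + (C * K) * (C * K * P₂) + (C * K) * (K * #(slice n m) * Sa) := by
    have h := ncc_sum_X_sq (n := n) k m
    have h' : (∑ y ∈ slice n m, (Xc⟦n, k, y⟧ : ℝ) ^ 2) = ∑ ae ∈ 𝒫⟦n, k⟧, ∑ be ∈ 𝒫⟦n, k⟧,
        (#((slice n m).filter fun y => Pat⟦ae.1, ae.2, y⟧ ∧ Pat⟦be.1, be.2, y⟧) : ℝ) := by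
      exact_mod_cast h
    rw [h']
    calc ∑ ae ∈ 𝒫⟦n, k⟧, ∑ be ∈ 𝒫⟦n, k⟧,
          (#((slice n m).filter fun y => Pat⟦ae.1, ae.2, y⟧ ∧ Pat⟦be.1, be.2, y⟧) : ℝ)
        ≤ ∑ ae ∈ 𝒫⟦n, k⟧, ((#((slice n m).filter fun y => Pat⟦ae.1, ae.2, y⟧) : ℝ) +
            ((C : ℝ) * K * P₂ + (K : ℝ) * #(slice n m) * Sa)) := by
          refine sum_le_sum fun ae hae => ?_
          obtain ⟨hae1, hae2⟩ := mem_filter.1 hae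
          have := ncc_inner_le (m := m) (mem_product.1 hae1).1 hae2 hp0 hp1 hmN hN hmp
          linarith
      _ = (∑ ae ∈ 𝒫⟦n, k⟧, (#((slice n m).filter fun y => Pat⟦ae.1, ae.2, y⟧) : ℝ)) +
            #𝒫⟦n, k⟧ * ((C : ℝ) * K * P₂ + (K : ℝ) * #(slice n m) * Sa) := by
          rw [sum_add_distrib, sum_const, nsmul_eq_mul]
      _ = (C : ℝ) * K * P₁ + (C * K) * (C * K * P₂) + (C * K) * (K * #(slice n m) * Sa) := by
          have h1 : (∑ ae ∈ 𝒫⟦n, k⟧, (#((slice n m).filter fun y => Pat⟦ae.1, ae.2, y⟧) : ℝ)) =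
              (C : ℝ) * K * P₁ := by
            rw [← hTot]
            exact_mod_cast (ncc_sum_X_eq (n := n) k m).symm
          rw [h1, ncc_card_pairs]
          push_cast
          ring
  -- R1: the single-pattern lower bound `M ℓ^{K-1} ≤ 2 P₁`
  have hR1 : (#(slice n m) : ℝ) * ℓ ^ (K - 1) ≤ 2 * P₁ := by
    have h := ncc_single_ge N m K (by omega) (by omega)
    have hR : (#(slice n m) : ℝ) * ((m + 2 - K : ℕ) : ℝ) ^ (K - 1) * ((N - m : ℕ) : ℝ) ≤
        (P₁ : ℝ) * (N : ℝ) ^ K := by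
      rw [hM]
      exact_mod_cast h
    have h1 : ℓ * N ≤ ((m + 2 - K : ℕ) : ℝ) := by
      rw [Nat.cast_sub (by omega)]
      push_cast
      linarith
    have h2 : (N : ℝ) ≤ 2 * ((N - m : ℕ) : ℝ) := by
      rw [Nat.cast_sub hmN]
      have : ((2 * m : ℕ) : ℝ) ≤ N := by exact_mod_cast h2m
      push_cast at this
      linarith
    have hNpos : (0 : ℝ) < (N : ℝ) ^ K := by positivity
    have hℓN : 0 ≤ ℓ * N := by positivity
    have key : (#(slice n m) : ℝ) * ℓ ^ (K - 1) * (N : ℝ) ^ K ≤ 2 * P₁ * (N : ℝ) ^ K := by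
      calc (#(slice n m) : ℝ) * ℓ ^ (K - 1) * (N : ℝ) ^ K
          = #(slice n m) * (ℓ * N) ^ (K - 1) * N := by
            rw [mul_pow, show (N : ℝ) ^ K = (N : ℝ) ^ (K - 1) * N by
              rw [← pow_succ]; congr 1; omega]
            ring
        _ ≤ #(slice n m) * ((m + 2 - K : ℕ) : ℝ) ^ (K - 1) * (2 * ((N - m : ℕ) : ℝ)) := by gcongr
        _ = 2 * ((#(slice n m) : ℝ) * ((m + 2 - K : ℕ) : ℝ) ^ (K - 1) * ((N - m : ℕ) : ℝ)) := by ring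
        _ ≤ 2 * ((P₁ : ℝ) * (N : ℝ) ^ K) := by linarith
        _ = _ := by ring
    exact le_of_mul_le_mul_right key hNpos
  -- R2: far pairs versus single patterns
  have hR2 : (#(slice n m) : ℝ) * P₂ ≤ (P₁ : ℝ) ^ 2 * ((N : ℝ) / (N + 1 - 2 * K)) ^ K := by
    have h := ncc_pair_le_single_sq N m K (by omega) (by omega) (by omega)
    have hD1 : (N.descFactorial K : ℝ) ≤ (N : ℝ) ^ K := by exact_mod_cast Nat.descFactorial_le_pow N K
    have hD2 : ((N + 1 - 2 * K : ℕ) : ℝ) ^ K ≤ ((N - K).descFactorial K : ℝ) := by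
      have := Nat.pow_sub_le_descFactorial (N - K) K
      rw [show N - K + 1 - K = N + 1 - 2 * K by omega] at this
      exact_mod_cast this
    have hpos : (0 : ℝ) < ((N + 1 - 2 * K : ℕ) : ℝ) ^ K :=
      pow_pos (by exact_mod_cast (show 0 < N + 1 - 2 * K by omega)) K
    have hcast : ((N + 1 - 2 * K : ℕ) : ℝ) = (N : ℝ) + 1 - 2 * K := by
      rw [Nat.cast_sub (by omega)]
      push_cast
      ring
    have key : (#(slice n m) : ℝ) * P₂ * ((N + 1 - 2 * K : ℕ) : ℝ) ^ K ≤ (P₁ : ℝ) ^ 2 * (N : ℝ) ^ K := by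
      have h' : (#(slice n m) : ℝ) * P₂ * ((N - K).descFactorial K : ℝ) ≤
          (P₁ : ℝ) ^ 2 * (N.descFactorial K : ℝ) := by
        rw [hM]
        exact_mod_cast h
      calc _ ≤ (#(slice n m) : ℝ) * P₂ * ((N - K).descFactorial K : ℝ) := by gcongr
        _ ≤ (P₁ : ℝ) ^ 2 * (N.descFactorial K : ℝ) := h'
        _ ≤ _ := by gcongr
    rw [div_pow, ← hcast, mul_div_assoc', le_div_iff₀ hpos]
    exact key
  -- assembly
  have hM0 : (0 : ℝ) ≤ #(slice n m) := Nat.cast_nonneg _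
  have hP₁0 : (0 : ℝ) ≤ P₁ := Nat.cast_nonneg _
  have hℓ' : ℓ ≠ 0 := hℓ.ne'
  have E1 : (#(slice n m) : ℝ) * ((C : ℝ) * K * P₁) ≤
      2 / ((C : ℝ) * K * ℓ ^ (K - 1)) * ((C : ℝ) * K * P₁) ^ 2 := by
    have hM' : (#(slice n m) : ℝ) ≤ 2 * P₁ / ℓ ^ (K - 1) := by
      rw [le_div_iff₀ (pow_pos hℓ _)]
      exact hR1
    calc (#(slice n m) : ℝ) * ((C : ℝ) * K * P₁) ≤ (2 * P₁ / ℓ ^ (K - 1)) * ((C : ℝ) * K * P₁) :=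
          mul_le_mul_of_nonneg_right hM' (by positivity)
      _ = _ := by
          field_simp
  have E2 : ((C : ℝ) * K) * ((C : ℝ) * K * P₂) * #(slice n m) ≤
      ((N : ℝ) / (N + 1 - 2 * K)) ^ K * ((C : ℝ) * K * P₁) ^ 2 := by
    calc ((C : ℝ) * K) * ((C : ℝ) * K * P₂) * #(slice n m) = ((C : ℝ) * K) ^ 2 * ((#(slice n m) : ℝ) * P₂) := by
          ring
      _ ≤ ((C : ℝ) * K) ^ 2 * ((P₁ : ℝ) ^ 2 * ((N : ℝ) / (N + 1 - 2 * K)) ^ K) :=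
          mul_le_mul_of_nonneg_left hR2 (by positivity)
      _ = _ := by ring
  have E3 : ((C : ℝ) * K) * ((K : ℝ) * #(slice n m) * Sa) * #(slice n m) ≤
      4 * Sa / ((C : ℝ) * ℓ ^ (2 * K - 2)) * ((C : ℝ) * K * P₁) ^ 2 := by
    have hM2 : (#(slice n m) : ℝ) ^ 2 ≤ 4 * (P₁ : ℝ) ^ 2 / ℓ ^ (2 * K - 2) := by
      rw [le_div_iff₀ (pow_pos hℓ _)]
      have hpow : ℓ ^ (2 * K - 2) = (ℓ ^ (K - 1)) ^ 2 := by
        rw [← pow_mul]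
        congr 1
        omega
      calc (#(slice n m) : ℝ) ^ 2 * ℓ ^ (2 * K - 2) = ((#(slice n m) : ℝ) * ℓ ^ (K - 1)) ^ 2 := by
            rw [hpow]
            ring
        _ ≤ (2 * (P₁ : ℝ)) ^ 2 := pow_le_pow_left₀ (by positivity) hR1 2
        _ = 4 * (P₁ : ℝ) ^ 2 := by ring
    calc ((C : ℝ) * K) * ((K : ℝ) * #(slice n m) * Sa) * #(slice n m)
        = (C : ℝ) * K ^ 2 * Sa * (#(slice n m) : ℝ) ^ 2 := by ring
      _ ≤ (C : ℝ) * K ^ 2 * Sa * (4 * (P₁ : ℝ) ^ 2 / ℓ ^ (2 * K - 2)) :=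
          mul_le_mul_of_nonneg_left hM2 (by positivity)
      _ = _ := by
          field_simp
  rw [hTot, add_mul, add_mul]
  have hfin := mul_le_mul_of_nonneg_left hsq hM0
  have halg : (#(slice n m) : ℝ) *
      ((C : ℝ) * K * P₁ + (C * K) * (C * K * P₂) + (C * K) * (K * #(slice n m) * Sa)) =
      #(slice n m) * ((C : ℝ) * K * P₁) + ((C : ℝ) * K) * ((C : ℝ) * K * P₂) * #(slice n m) +
        ((C : ℝ) * K) * ((K : ℝ) * #(slice n m) * Sa) * #(slice n m) := by ring
  rw [halg] at hfin
  linarith [hfin, E1, E2, E3]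


/-- **Registered sub-goal of the Moment file** (the second-moment bound at explicit largeness hypotheses,
`∀`-form of `ncc_moment_bound`, notation expanded). [folklore] -/
theorem ncc_moment_pkg :
    ∀ n k m : ℕ, ∀ ℓ p : ℝ, 3 ≤ k → k ≤ n → 2 * m ≤ n.choose 2 → 2 * k.choose 2 ≤ m → 0 < ℓ →
      ℓ * n.choose 2 + k.choose 2 ≤ m + 2 → (m : ℝ) ≤ p * n.choose 2 → p ≤ 1 →
      (#(slice n m) : ℝ) * ∑ y ∈ slice n m,
          (#(((powersetCard k (univ : Finset (Fin n)) ×ˢ (univ : Finset (Edge n))).filter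
            fun ae => ae.2 ∈ edgesIn ae.1).filter
            fun ae => (∀ e' ∈ edgesIn ae.1, e' ≠ ae.2 → y e' = true) ∧ y ae.2 = false) : ℝ) ^ 2 ≤
        (2 / ((n.choose k : ℝ) * k.choose 2 * ℓ ^ (k.choose 2 - 1)) +
          ((n.choose 2 : ℝ) / (n.choose 2 + 1 - 2 * k.choose 2)) ^ k.choose 2 +
          4 * (∑ a ∈ Ico 2 k, (k.choose a : ℝ) * (n - k).choose (k - a) *
            p ^ (2 * k.choose 2 - a.choose 2 - 2)) / ((n.choose k : ℝ) * ℓ ^ (2 * k.choose 2 - 2))) *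
        (∑ y ∈ slice n m,
          (#(((powersetCard k (univ : Finset (Fin n)) ×ˢ (univ : Finset (Edge n))).filter
            fun ae => ae.2 ∈ edgesIn ae.1).filter
            fun ae => (∀ e' ∈ edgesIn ae.1, e' ≠ ae.2 → y e' = true) ∧ y ae.2 = false) : ℝ)) ^ 2 :=
  fun _ _ _ _ _ hk hkn h2m hKm hℓ hℓm hmp hp1 => ncc_moment_bound hk hkn h2m hKm hℓ hℓm hmp hp1

end Moment

end Summit.PneNP.PneNP.Cruxes.ConstantBand.FlatPriorRelativeMinterms

end
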